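import Literature.MathematicalPhysics.QuantumFieldTheory.Balaban1983to89.Beta.PlaquetteVertex2Trace

/-!
# `Balaban1983to89.Beta.ContactWordCurl` — THE (N² − 1)-WEIGHTED PART OF THE TRACED (2,2) PLAQUETTE VERTEX IS A PRODUCT OF THE TWO
PLAQUETTE CURLS: `Σ_{ijkl} (N²−1)·s_i s_j·½qq_kl · w_i w_j b_k b_l = ¼(N²−1)·(Σ_i s_i w_i)²·(Σ_k s_k b_k)²`, and the N²-part has NO
position-diagonal (contact) cell

(β sub-cell of `pub-balaban`, row BETA-lit1 = normalisation / colour-dictionary seat, gen 21; the kernel backbone of the seat's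
advisory A-lit1g21-1 on the β-lead's IDENT-122-CHECKLIST tick (β) «the only N in β⁰_j is the N² of `stepBal N Lc`».  Cell records:
GAPS A-lit1g21-1, CITED-FACTS S-lit1-35 and S-lit1-36, BETA/LIT1.md §28.)

HONEST FRAMING (cell rule, verbatim): discharging `BetaPertH` makes Bałaban's UV stability UNCONDITIONAL — a real constructive-QFT
result; it is NOT the continuum limit and NOT the Clay problem.  THIS MODULE DISCHARGES NOTHING of the series and instantiates no
binder of the wall: it is finite real algebra on an3's explicit `Fin 4`-indexed position tables `sgn`, `qq`, `inc`, `w22` of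
`Beta.PlaquetteVertex2Coords` / `…Polar` / `…Trace` (lineage an3, p188386 / p188662 / p188809), evaluated against COMMUTING real test
components `w, b : Fin 4 → ℝ` (one colour component of the fluctuation / background letters on the four plaquette edges).  It says
nothing about which N-power reaches Bałaban's β⁰_j — that is the untyped question the advisory NAMES, not one it answers.

ABSOLUTE RULE (cell charter, verbatim in substance).  No internally-minted statement enters as a cited fact: no hypothesis at all
(closed identities between explicit tables); NOTHING is cited.  Printed CONTEXT (quoted in the cell records, not used): Dashen–Gross,
PRD 23 (1981) 2340, (3.16) «S_T = −(a⁴/48Ng²) Σ (F^{αβ}(x))² Σ_{ν>μ} tr(Δ_μα^ν(x) − Δ_να^μ(x))²» — the quartic term of the bounded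
Wilson action, background curvature² × fluctuation curl² at one site —, (4.1) «I₁ = −⟨S_T⟩_a = (N²−1)/(32N) ∫d⁴x (F^α_{μν})²», p. 2346
«this term, unlike all the other terms that we encounter, is not proportional to N».  The identity below exhibits the SAME structure
inside an3's traced table: its (N²−1)-weighted part is exactly ¼(N²−1)·(curl_p w)²·(curl_p b)².

WHAT IS DERIVED (every declaration `[folklore]`; no `def`, no `axiom`, no `sorry`).
* `sum_sgn_sgn_mul` : `Σ_{i,j} s_i s_j (w_i w_j) = (Σ_i s_i w_i)²` (the fluctuation curl pattern);
* `sum_qq_mul` : `Σ_{k,l} qq_kl (b_k b_l) = ½(Σ_k s_k b_k)²` (the scalar-slot table `qq k l = [k<l]s_ks_l + [k=l]½` of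
  `PlaquetteVertex2Polar.qq_eq_ite` against commuting components is half the background curl squared);
* **`bpart_eq_curl_curl`** : `Σ_{ijkl} (N²−1)·(s_i s_j·(½qq_kl))·(w_i w_j (b_k b_l)) = ¼(N²−1)·(Σ s_i w_i)²·(Σ s_k b_k)²`;
* `apart_diag` : the N²-table `A` of `PlaquetteVertex2Trace.w22_eq_sq_add` VANISHES on the position diagonal `i = j` (so the contact
  contraction of `w22` is purely (N²−1)-weighted — `PlaquetteVertex2Trace.sum_w22_diag` — by a termwise zero, not by cancellation);
* **`w22_form_split`** : the traced vertex as a quadratic form,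
  `Σ_{ijkl} w22 N i j k l·(w_i w_j (b_k b_l)) = N²·Σ_{ijkl} A_{ijkl}·(w_i w_j (b_k b_l)) + ¼(N²−1)·(Σ s_i w_i)²·(Σ s_k b_k)²`;
* numerical instances at N = 2 (`example`s).

References: none cited (all [folklore]).
-/

namespace Literature.MathematicalPhysics.QuantumFieldTheory.Balaban1983to89.Beta.ContactWordCurl

open Finset
open scoped BigOperators
open Literature.MathematicalPhysics.QuantumFieldTheory.Balaban1983to89.Beta.PlaquetteVertex2Coords (sgn)
open Literature.MathematicalPhysics.QuantumFieldTheory.Balaban1983to89.Beta.PlaquetteVertex2Polar (qq inc)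
open Literature.MathematicalPhysics.QuantumFieldTheory.Balaban1983to89.Beta.PlaquetteVertex2Trace (w22 wSym wPair)

/-- THE FLUCTUATION CURL PATTERN: `Σ_{i,j} s_i s_j (w_i w_j) = (Σ_i s_i w_i)²`. [folklore] -/
theorem sum_sgn_sgn_mul (w : Fin 4 → ℝ) : ∑ i, ∑ j, sgn i * sgn j * (w i * w j) = (∑ i, sgn i * w i) ^ 2 := by
  rw [sq, Finset.sum_mul_sum]
  refine Finset.sum_congr rfl fun i _ => Finset.sum_congr rfl fun j _ => ?_
  ring

/-- THE SCALAR-SLOT TABLE AGAINST COMMUTING COMPONENTS IS HALF THE BACKGROUND CURL SQUARED: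
`Σ_{k,l} qq_kl (b_k b_l) = ½(Σ_k s_k b_k)²` (`qq k l = [k<l]·s_k s_l + [k=l]·½`). [folklore] -/
theorem sum_qq_mul (b : Fin 4 → ℝ) : ∑ k, ∑ l, qq k l * (b k * b l) = 2⁻¹ * (∑ k, sgn k * b k) ^ 2 := by
  simp [Fin.sum_univ_four, qq, sgn]
  ring

/-- **THE (N²−1)-WEIGHTED PART OF THE TRACED (2,2) VERTEX FACTORISES INTO THE TWO PLAQUETTE CURLS**:
`Σ_{ijkl} (N²−1)·(s_i s_j·½qq_kl)·(w_i w_j (b_k b_l)) = ¼(N²−1)·(Σ_i s_i w_i)²·(Σ_k s_k b_k)²` — the `B`-table of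
`PlaquetteVertex2Trace.w22_eq_sq_add` is the «curl² × curl²» contact structure. [folklore] -/
theorem bpart_eq_curl_curl (N : ℕ) (w b : Fin 4 → ℝ) :
    ∑ i, ∑ j, ∑ k, ∑ l, ((N : ℝ) ^ 2 - 1) * (sgn i * sgn j * (2⁻¹ * qq k l)) * (w i * w j * (b k * b l))
      = 4⁻¹ * ((N : ℝ) ^ 2 - 1) * (∑ i, sgn i * w i) ^ 2 * (∑ k, sgn k * b k) ^ 2 := by
  simp [Fin.sum_univ_four, qq, sgn]
  ring

/-- THE N²-TABLE `A` OF `w22_eq_sq_add` VANISHES ON THE POSITION DIAGONAL `i = j` (termwise). [folklore] -/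
theorem apart_diag (i k l : Fin 4) :
    sgn i * sgn i * ((inc i k - inc i k) * (inc i l - 2⁻¹ * sgn l) + if i < i then (inc i k - inc i k) * sgn l else 0) = 0 := by
  simp

/-- … hence the position-diagonal of `w22` is the (N²−1)-part alone: `w22 N i i k l = (N²−1)·(½ qq k l)` (`s_i² = 1`; cf. the summed
form `PlaquetteVertex2Trace.sum_w22_diag`). [folklore] -/
theorem w22_diag (N : ℕ) (i k l : Fin 4) : w22 N i i k l = ((N : ℝ) ^ 2 - 1) * (2⁻¹ * qq k l) := by
  have hs : sgn i * sgn i = 1 := by fin_cases i <;> simp [sgn]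
  rw [PlaquetteVertex2Trace.w22_eq_sq_add, apart_diag, mul_zero, zero_add, hs, one_mul]

/-- **THE TRACED VERTEX AS A QUADRATIC FORM, SPLIT BY N-POWER**: against commuting components
`Σ_{ijkl} w22 N i j k l·(w_i w_j (b_k b_l)) = N²·Σ_{ijkl} A_{ijkl}·(w_i w_j (b_k b_l)) + ¼(N²−1)·(Σ s_i w_i)²·(Σ s_k b_k)²`, with the
N-free table `A_{ijkl} = s_i s_j((inc_{jk} − inc_{ik})(inc_{jl} − ½s_l) + [i<j](inc_{ik} − inc_{jk})s_l)` of `w22_eq_sq_add`. [folklore] -/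
theorem w22_form_split (N : ℕ) (w b : Fin 4 → ℝ) :
    ∑ i, ∑ j, ∑ k, ∑ l, w22 N i j k l * (w i * w j * (b k * b l))
      = (N : ℝ) ^ 2 * ∑ i, ∑ j, ∑ k, ∑ l, (sgn i * sgn j * ((inc j k - inc i k) * (inc j l - 2⁻¹ * sgn l)
            + if i < j then (inc i k - inc j k) * sgn l else 0)) * (w i * w j * (b k * b l))
        + 4⁻¹ * ((N : ℝ) ^ 2 - 1) * (∑ i, sgn i * w i) ^ 2 * (∑ k, sgn k * b k) ^ 2 := by
  rw [← bpart_eq_curl_curl, Finset.mul_sum, ← Finset.sum_add_distrib]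
  refine Finset.sum_congr rfl fun i _ => ?_
  rw [Finset.mul_sum, ← Finset.sum_add_distrib]
  refine Finset.sum_congr rfl fun j _ => ?_
  rw [Finset.mul_sum, ← Finset.sum_add_distrib]
  refine Finset.sum_congr rfl fun k _ => ?_
  rw [Finset.mul_sum, ← Finset.sum_add_distrib]
  refine Finset.sum_congr rfl fun l _ => ?_
  rw [PlaquetteVertex2Trace.w22_eq_sq_add]
  ring

/-! ## N = 2 instances (Bałaban's SU(2): `N² = 4`, `N² − 1 = 3`) -/

/-- at N = 2 the contact part is `¾·(curl w)²·(curl b)²`. -/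
example (w b : Fin 4 → ℝ) :
    ∑ i, ∑ j, ∑ k, ∑ l, ((2 : ℕ) ^ 2 - 1 : ℝ) * (sgn i * sgn j * (2⁻¹ * qq k l)) * (w i * w j * (b k * b l))
      = 4⁻¹ * 3 * (∑ i, sgn i * w i) ^ 2 * (∑ k, sgn k * b k) ^ 2 := by
  have h := bpart_eq_curl_curl 2 w b
  norm_num at h ⊢
  linarith [h]

/-- the diagonal cell of the traced table at N = 2: `w22 2 i i k k = 3·¼ = ¾` on the doubly-diagonal cells. -/
example (i k : Fin 4) : w22 2 i i k k = 3 / 4 := by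
  rw [w22_diag]
  have : qq k k = 2⁻¹ := by fin_cases k <;> simp [qq]
  rw [this]
  norm_num

end Literature.MathematicalPhysics.QuantumFieldTheory.Balaban1983to89.Beta.ContactWordCurl
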